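import Mathlib
import Literature.MathematicalPhysics.QuantumFieldTheory.Balaban1983to89.B6Lemma21Arith

/-!
# `Balaban1983to89.B6Lemma21Counterexample` — the printed constant of Lemma 2.1 (B6) is exceeded in d = 4

CITATION HEADER (lean-in-tree rule 2026-08-18). Source: T. Bałaban, *Propagators and renormalization transformations for
lattice gauge theories. II*, Comm. Math. Phys. **96**, 223–250 (1984) [Balaban1984PropagatorsII] (cell paper B6; PDF
`paper:balaban1984-cmp96-propagators-rt-ii`, journal page = PDF page + 222). The manuscript is under adjudication: nothing
below cites it for a disputed step; the statements below are kernel-checked from Mathlib alone.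

WHAT IS CHECKED (no `sorry`):
* `c0_closed`: c₀(δ₀, α) = Σ_{z∈ℤ} e^{−αδ₀|z|} = (1 + e^{−αδ₀})/(1 − e^{−αδ₀}) for αδ₀ > 0.
* `sum_exp_ge_of_paths`: in ANY finite site set with a distance `dist`, if distinct sites `f i` (i ∈ I) satisfy
  `dist y (f i) ≤ b i`, then Σ_{y′} e^{−a·dist(y,y′)} ≥ Σ_{i∈I} e^{−a·b i} (a ≥ 0).
* `witnessSum_le_sum`: the WITNESS FAMILY of the d = 4, L = 32 slab geometry (see the GAPS row G-A11-1): fine sites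
  (−(t+1), 32(k₁−N)+(ρ₁−15), 32(k₂−N)+(ρ₂−15), 32(k₃−N)+(ρ₃−15)) reached in ≤ 4 + t + Σ|k_i − N| + Σ|ρ_i − 15|
  admissible bonds (fine bond into the face, one coarse bond inward, coarse ℓ¹ travel in the layer x₁ = 32, one coarse
  bond back to the face, one fine bond out, fine ℓ¹ travel in Λ₀), and coarse sites (32m, 32(k_i − N)) reached in
  ≤ 1 + m + Σ|k_i − N| bonds — under these path bounds and injectivity of the site map, the (2.61) sum at y dominates the
  factorised `witnessSum`.
* `p_bounds`, `q_bounds`: 0.9394 < e^{−1/16} < 0.9395 (from `Real.exp_one_gt_d9`/`lt_d9` via (e^{−1/16})¹⁶ = e^{−1}),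
  hence e^{−1/8} > 0.9394².
* `witnessSum_gt_c1`: for αδ₀ = 1/8 the truncated witness sum (T₀ = N = M₀ = 24) EXCEEDS the printed
  c₁(α) = 12 c₀⁴(½α) = `B6.c1 4 δ₀ α` (numerically 4.6·10⁷ > 1.27·10⁷; both sides enclosed by rationals).
* `printed_c1_exceeded`: the assembled statement — in any finite geometry carrying the witness family with the stated
  path bounds, sup_{y} Σ_{y′} e^{−αδ₀ d(y,y′)} > `B6.c1 4 δ₀ α` at αδ₀ = 1/8, i.e. the printed (2.61) FAILS for d = 4.

WHAT IS NOT KERNEL-CHECKED (stated as hypotheses of `printed_c1_exceeded`, discharged in prose + BFS engines in the GAPS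
row): that the concrete slab geometry (T_η = (ℤ/N)⁴, Ω₁ = B¹(slab of big blocks), k = 1, L = 32) realises the path
bounds — routine ℓ¹-convexity of half-spaces, verified bond-by-bond by breadth-first search in d = 2 (exact equality with
the closed form) and d = 3 (37 828 witness sites, 0 violations); and that the (2.46) infimum is the admissible-bond count
(dictionary D-pv08g2.1 of `B6Geometry`).

LOCATED CAUSE (print): (2.57) is asserted for l = 1, …, m with y_{m+1} = y′ (2.47), but y′ ∈ Λ_{j′} does not lie on a
surface, so the last piece Γ_{y′_m, y′} carries NO separation factor; the display (2.58) therefore has one factor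
e^{−½αδ₀RM} too many (it already fails for m = 1, j = j′). Repaired bound: Σ_{m} e^{−½αδ₀(m−1)⁺RM} c₀^{d(2m+1)}, giving
c₁(α) = O(1)·c₀^{3d}(½α) under the same (2.59) — Lemma 2.1 survives with that constant; consumers use c₁ only as O(1).
-/

namespace Literature.MathematicalPhysics.QuantumFieldTheory.Balaban1983to89.B6Lemma21Counterexample

open Real Finset

/-! ## 1. Closed form of c₀ -/

/-- `Σ_{z∈ℤ} e^{−a|z|} = (1 + e^{−a})/(1 − e^{−a})` for `a > 0`. [folklore] -/
theorem tsum_int_exp_neg_abs_mul {a : ℝ} (ha : 0 < a) :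
    ∑' z : ℤ, Real.exp (-(a * |(z : ℝ)|)) = (1 + Real.exp (-a)) / (1 - Real.exp (-a)) := by
  have hr : Real.exp (-a) < 1 := by rw [Real.exp_lt_one_iff]; linarith
  have hr0 : 0 ≤ Real.exp (-a) := (Real.exp_pos _).le
  have hnat_eq : (fun n : ℕ => Real.exp (-(a * |((n : ℤ) : ℝ)|))) = fun n : ℕ => Real.exp (-a) ^ n := by
    funext n
    rw [← Real.exp_nat_mul]; congr 1; push_cast
    rw [abs_of_nonneg (by positivity)]; ring
  have hneg_eq : (fun n : ℕ => Real.exp (-(a * |((-((n : ℤ) + 1) : ℤ) : ℝ)|)))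
      = fun n : ℕ => Real.exp (-a) * Real.exp (-a) ^ n := by
    funext n
    rw [← pow_succ', ← Real.exp_nat_mul]; congr 1; push_cast
    rw [abs_neg, abs_of_nonneg (by positivity)]; ring
  have hnat : Summable fun n : ℕ => Real.exp (-(a * |((n : ℤ) : ℝ)|)) := by
    rw [hnat_eq]; exact summable_geometric_of_lt_one hr0 hr
  have hneg : Summable fun n : ℕ => Real.exp (-(a * |((-((n : ℤ) + 1) : ℤ) : ℝ)|)) := by
    rw [hneg_eq]; exact (summable_geometric_of_lt_one hr0 hr).mul_left _
  have h1 : ∑' n : ℕ, Real.exp (-(a * |((n : ℤ) : ℝ)|)) = (1 - Real.exp (-a))⁻¹ := by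
    rw [hnat_eq]; exact tsum_geometric_of_lt_one hr0 hr
  have h2 : ∑' n : ℕ, Real.exp (-(a * |((-((n : ℤ) + 1) : ℤ) : ℝ)|))
      = Real.exp (-a) * (1 - Real.exp (-a))⁻¹ := by
    rw [hneg_eq, tsum_mul_left, tsum_geometric_of_lt_one hr0 hr]
  rw [tsum_of_nat_of_neg_add_one (f := fun z : ℤ => Real.exp (-(a * |(z : ℝ)|))) hnat hneg]
  rw [h1, h2, div_eq_mul_inv]
  ring

/-- `c₀(δ₀, α) = (1 + e^{−αδ₀})/(1 − e^{−αδ₀})` for `αδ₀ > 0`. [cite: Balaban1984PropagatorsII, p.233 (c₀(α) definition)] [folklore] -/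
theorem c0_closed {δ₀ α : ℝ} (h : 0 < α * δ₀) :
    B6.c0 δ₀ α = (1 + Real.exp (-(α * δ₀))) / (1 - Real.exp (-(α * δ₀))) := by
  unfold B6.c0
  exact tsum_int_exp_neg_abs_mul h

/-! ## 2. The abstract lower bound: distinct sites with path bounds -/

/-- If distinct sites `f i` (`i ∈ I`, `f` injective on `I`) satisfy `dist y (f i) ≤ b i`, then
`Σ_{i∈I} e^{−a b i} ≤ Σ_{y′} e^{−a dist(y,y′)}` for `a ≥ 0`. [folklore] -/
theorem sum_exp_ge_of_paths {S ι : Type*} [Fintype S] [DecidableEq S]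
    (dist : S → S → ℝ) (y : S) (a : ℝ) (ha : 0 ≤ a)
    (I : Finset ι) (f : ι → S) (hf : Set.InjOn f ↑I) (b : ι → ℝ)
    (hb : ∀ i ∈ I, dist y (f i) ≤ b i) :
    ∑ i ∈ I, Real.exp (-(a * b i)) ≤ ∑ y' : S, Real.exp (-(a * dist y y')) := by
  calc ∑ i ∈ I, Real.exp (-(a * b i)) ≤ ∑ i ∈ I, Real.exp (-(a * dist y (f i))) := by
        apply Finset.sum_le_sum
        intro i hi
        apply Real.exp_le_exp.2
        have := mul_le_mul_of_nonneg_left (hb i hi) ha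
        linarith
    _ = ∑ y' ∈ I.image f, Real.exp (-(a * dist y y')) :=
        (Finset.sum_image (f := fun y' => Real.exp (-(a * dist y y')))
          (fun x hx z hz hxz => hf hx hz hxz)).symm
    _ ≤ ∑ y' : S, Real.exp (-(a * dist y y')) :=
        Finset.sum_le_sum_of_subset_of_nonneg (Finset.subset_univ _)
          (fun _ _ _ => (Real.exp_pos _).le)

/-! ## 3. The witness family (d = 4, L = 32) and its factorised sum -/

/-- Transverse weight `|k − N|` as a natural number (`k ∈ range (2N+1)` ↦ coordinate `k − N ∈ [−N, N]`). [folklore] -/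
def wN (N k : ℕ) : ℕ := if k ≤ N then N - k else k - N

/-- Transverse coordinate `32(k − N) + (ρ − 15)` (`ρ ∈ range 32` ↦ residue `ρ − 15 ∈ [−15, 16]`). [folklore] -/
def coord (N k ρ : ℕ) : ℤ := 32 * ((k : ℤ) - N) + ((ρ : ℤ) - 15)

/-- Coarse transverse coordinate `32(k − N)`. [folklore] -/
def ccoord (N k : ℕ) : ℤ := 32 * ((k : ℤ) - N)

/-- Index of a fine witness site: depth `t` (site at `x₁ = −(t+1)`), transverse cells `k = (k₁,k₂,k₃)`,
residues `ρ = (ρ₁,ρ₂,ρ₃)`. [folklore] -/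
abbrev FineIdx := ℕ × ((ℕ × ℕ × ℕ) × (ℕ × ℕ × ℕ))
/-- Index of a coarse witness site: depth `m` (site at `x₁ = 32m`), transverse cells `k`. [folklore] -/
abbrev CoarseIdx := ℕ × (ℕ × ℕ × ℕ)

/-- The cube `range(2N+1)³`. [folklore] -/
def cube (N : ℕ) : Finset (ℕ × ℕ × ℕ) := range (2 * N + 1) ×ˢ (range (2 * N + 1) ×ˢ range (2 * N + 1))
/-- The residue cube `range 32 ³`. [folklore] -/
def rcube : Finset (ℕ × ℕ × ℕ) := range 32 ×ˢ (range 32 ×ˢ range 32)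

/-- Fine index set: `t < T₀`, `k ∈ cube N`, `ρ ∈ rcube`. [folklore] -/
def fineIdx (T₀ N : ℕ) : Finset FineIdx := range T₀ ×ˢ (cube N ×ˢ rcube)
/-- Coarse index set: `m ≤ M₀`, `k ∈ cube N`. [folklore] -/
def coarseIdx (M₀ N : ℕ) : Finset CoarseIdx := range (M₀ + 1) ×ˢ cube N

/-- Sum of the three transverse weights. [folklore] -/
def w3 (N : ℕ) (k : ℕ × ℕ × ℕ) : ℕ := wN N k.1 + wN N k.2.1 + wN N k.2.2

/-- Path bound for a fine witness site: `4 + t + Σ|k_i − N| + Σ|ρ_i − 15|`. [folklore] -/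
def fineBound (N : ℕ) (i : FineIdx) : ℝ := 4 + i.1 + w3 N i.2.1 + w3 15 i.2.2
/-- Path bound for a coarse witness site: `1 + m + Σ|k_i − N|`. [folklore] -/
def coarseBound (N : ℕ) (i : CoarseIdx) : ℝ := 1 + i.1 + w3 N i.2

/-- One-dimensional transverse sum `Σ_{k<2N+1} e^{−a|k−N|}`. [folklore] -/
noncomputable def S1 (a : ℝ) (N : ℕ) : ℝ := ∑ k ∈ range (2 * N + 1), Real.exp (-(a * wN N k))
/-- One-dimensional residue sum `Σ_{ρ<32} e^{−a|ρ−15|}`. [folklore] -/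
noncomputable def SR (a : ℝ) : ℝ := ∑ ρ ∈ range 32, Real.exp (-(a * wN 15 ρ))
/-- Depth sum for fine sites `Σ_{t<T₀} e^{−a(4+t)}`. [folklore] -/
noncomputable def St (a : ℝ) (T₀ : ℕ) : ℝ := ∑ t ∈ range T₀, Real.exp (-(a * (4 + t)))
/-- Depth sum for coarse sites `Σ_{m≤M₀} e^{−a(1+m)}`. [folklore] -/
noncomputable def Sm (a : ℝ) (M₀ : ℕ) : ℝ := ∑ m ∈ range (M₀ + 1), Real.exp (-(a * (1 + m)))

/-- The factorised witness sum `St·(S1·SR)³ + Sm·S1³`. [folklore] -/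
noncomputable def witnessSum (a : ℝ) (T₀ N M₀ : ℕ) : ℝ :=
  St a T₀ * (S1 a N * SR a) ^ 3 + Sm a M₀ * S1 a N ^ 3

/-- Pair factorisation `Σ_{(i,j)∈s×s} e^{−a(w i + w j)} = (Σ_k e^{−a w k})²`. [folklore] -/
theorem sum_pair (s : Finset ℕ) (w : ℕ → ℕ) (a : ℝ) :
    ∑ p ∈ s ×ˢ s, Real.exp (-(a * ((w p.1 + w p.2 : ℕ) : ℝ)))
      = (∑ k ∈ s, Real.exp (-(a * (w k : ℝ)))) ^ 2 := by
  rw [pow_two, Finset.sum_mul_sum, Finset.sum_product]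
  apply Finset.sum_congr rfl
  intro i _
  apply Finset.sum_congr rfl
  intro j _
  rw [← Real.exp_add]
  congr 1
  push_cast
  ring

/-- Triple factorisation `Σ_{(i,j,k)∈s×s×s} e^{−a(w i + w j + w k)} = (Σ_k e^{−a w k})³`. [folklore] -/
theorem sum_triple (s : Finset ℕ) (w : ℕ → ℕ) (a : ℝ) :
    ∑ p ∈ s ×ˢ (s ×ˢ s), Real.exp (-(a * ((w p.1 + w p.2.1 + w p.2.2 : ℕ) : ℝ)))
      = (∑ k ∈ s, Real.exp (-(a * (w k : ℝ)))) ^ 3 := by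
  rw [show ∀ x : ℝ, x ^ 3 = x * x ^ 2 from fun x => by ring, ← sum_pair, Finset.sum_mul_sum,
    Finset.sum_product]
  apply Finset.sum_congr rfl
  intro i _
  apply Finset.sum_congr rfl
  intro j _
  rw [← Real.exp_add]
  congr 1
  push_cast
  ring

/-- `Σ_{k ∈ cube N} e^{−a·w3 N k} = S1³`. [folklore] -/
theorem sum_cube (a : ℝ) (N : ℕ) :
    ∑ k ∈ cube N, Real.exp (-(a * w3 N k)) = S1 a N ^ 3 := by
  unfold cube S1 w3
  exact sum_triple _ _ _

/-- `Σ_{ρ ∈ rcube} e^{−a·w3 15 ρ} = SR³`. [folklore] -/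
theorem sum_rcube (a : ℝ) :
    ∑ ρ ∈ rcube, Real.exp (-(a * w3 15 ρ)) = SR a ^ 3 := by
  unfold rcube SR w3
  exact sum_triple _ _ _

/-- `Σ_{i ∈ fineIdx} e^{−a·fineBound i} = St·(S1·SR)³`. [folklore] -/
theorem sum_fineIdx (a : ℝ) (T₀ N : ℕ) :
    ∑ i ∈ fineIdx T₀ N, Real.exp (-(a * fineBound N i)) = St a T₀ * (S1 a N * SR a) ^ 3 := by
  unfold fineIdx St
  rw [Finset.sum_product, Finset.sum_mul]
  apply Finset.sum_congr rfl
  intro t _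
  rw [mul_pow, ← sum_cube, ← sum_rcube, Finset.sum_mul_sum, Finset.mul_sum, Finset.sum_product]
  apply Finset.sum_congr rfl
  intro k _
  rw [Finset.mul_sum]
  apply Finset.sum_congr rfl
  intro ρ _
  unfold fineBound
  rw [← Real.exp_add, ← Real.exp_add]
  congr 1
  ring

/-- `Σ_{i ∈ coarseIdx} e^{−a·coarseBound i} = Sm·S1³`. [folklore] -/
theorem sum_coarseIdx (a : ℝ) (M₀ N : ℕ) :
    ∑ i ∈ coarseIdx M₀ N, Real.exp (-(a * coarseBound N i)) = Sm a M₀ * S1 a N ^ 3 := by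
  unfold coarseIdx Sm
  rw [Finset.sum_product, Finset.sum_mul]
  apply Finset.sum_congr rfl
  intro m _
  rw [← sum_cube, Finset.mul_sum]
  apply Finset.sum_congr rfl
  intro k _
  unfold coarseBound
  rw [← Real.exp_add]
  congr 1
  ring

/-- The combined index set and site map. [folklore] -/
def witnessIdx (T₀ N M₀ : ℕ) : Finset (FineIdx ⊕ CoarseIdx) :=
  (fineIdx T₀ N).disjSum (coarseIdx M₀ N)

/-- Site map: fine index ↦ `fine (t+1) (coord k ρ)`, coarse index ↦ `coarse m (ccoord k)`. [folklore] -/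
def siteMap {S : Type*} (N : ℕ) (fine : ℕ → ℤ × ℤ × ℤ → S) (coarse : ℕ → ℤ × ℤ × ℤ → S) :
    FineIdx ⊕ CoarseIdx → S :=
  Sum.elim
    (fun i => fine (i.1 + 1) (coord N i.2.1.1 i.2.2.1, coord N i.2.1.2.1 i.2.2.2.1, coord N i.2.1.2.2 i.2.2.2.2))
    (fun i => coarse i.1 (ccoord N i.2.1, ccoord N i.2.2.1, ccoord N i.2.2.2))

/-- Combined bound. [folklore] -/
def witnessBound (N : ℕ) : FineIdx ⊕ CoarseIdx → ℝ := Sum.elim (fineBound N) (coarseBound N)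

/-- **Witness lower bound.** In a finite site set with distance `dist`, if the witness sites are distinct and satisfy
the path bounds, then `witnessSum a T₀ N M₀ ≤ Σ_{y′} e^{−a·dist(y,y′)}`. [folklore] -/
theorem witnessSum_le_sum {S : Type*} [Fintype S] [DecidableEq S]
    (dist : S → S → ℝ) (y : S) (a : ℝ) (ha : 0 ≤ a) (T₀ N M₀ : ℕ)
    (fine coarse : ℕ → ℤ × ℤ × ℤ → S)
    (hinj : Set.InjOn (siteMap N fine coarse) ↑(witnessIdx T₀ N M₀))
    (hfine : ∀ i ∈ fineIdx T₀ N, dist y (siteMap N fine coarse (Sum.inl i)) ≤ fineBound N i)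
    (hcoarse : ∀ i ∈ coarseIdx M₀ N, dist y (siteMap N fine coarse (Sum.inr i)) ≤ coarseBound N i) :
    witnessSum a T₀ N M₀ ≤ ∑ y' : S, Real.exp (-(a * dist y y')) := by
  have hb : ∀ i ∈ witnessIdx T₀ N M₀, dist y (siteMap N fine coarse i) ≤ witnessBound N i := by
    intro i hi
    unfold witnessIdx at hi
    rcases i with i | i
    · exact hfine i (Finset.inl_mem_disjSum.1 hi)
    · exact hcoarse i (Finset.inr_mem_disjSum.1 hi)
  have h := sum_exp_ge_of_paths dist y a ha (witnessIdx T₀ N M₀) (siteMap N fine coarse) hinj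
    (witnessBound N) hb
  unfold witnessIdx at h
  rw [Finset.sum_disjSum] at h
  unfold witnessSum
  rw [← sum_fineIdx, ← sum_coarseIdx]
  simpa [witnessBound] using h

/-! ## 4. Numerics at αδ₀ = 1/8 -/

/-- `0.9394 < e^{−1/16} < 0.9395`. [folklore; from `Real.exp_one_gt_d9`, `Real.exp_one_lt_d9`] [folklore] -/
theorem p_bounds : 0.9394 < Real.exp (-(1 / 16 : ℝ)) ∧ Real.exp (-(1 / 16 : ℝ)) < 0.9395 := by
  set p := Real.exp (-(1 / 16 : ℝ)) with hp
  have hp0 : 0 < p := Real.exp_pos _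
  have h16 : p ^ 16 = Real.exp (-1) := by
    rw [hp, ← Real.exp_nat_mul]; congr 1; norm_num
  have he1 : Real.exp 1 < 2.7182818286 := Real.exp_one_lt_d9
  have he2 : 2.7182818283 < Real.exp 1 := Real.exp_one_gt_d9
  have hepos : 0 < Real.exp 1 := Real.exp_pos 1
  have hinv : Real.exp (-1) = (Real.exp 1)⁻¹ := Real.exp_neg 1
  have hlo : (1 / 2.7182818286 : ℝ) < Real.exp (-1) := by
    rw [hinv, one_div, inv_lt_inv₀ (by norm_num) hepos]; exact he1
  have hhi : Real.exp (-1) < 1 / 2.7182818283 := by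
    rw [hinv, one_div, inv_lt_inv₀ hepos (by norm_num)]; exact he2
  constructor
  · by_contra hcon
    push Not at hcon
    have : p ^ 16 ≤ (0.9394 : ℝ) ^ 16 := pow_le_pow_left₀ hp0.le hcon 16
    rw [h16] at this
    have : (0.9394 : ℝ) ^ 16 < 1 / 2.7182818286 := by norm_num
    linarith
  · by_contra hcon
    push Not at hcon
    have : (0.9395 : ℝ) ^ 16 ≤ p ^ 16 := pow_le_pow_left₀ (by norm_num) hcon 16
    rw [h16] at this
    have : (1 / 2.7182818283 : ℝ) < (0.9395 : ℝ) ^ 16 := by norm_num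
    linarith

/-- `0.9394² < e^{−1/8}`. [folklore] -/
theorem q_lower : (0.9394 : ℝ) ^ 2 < Real.exp (-(1 / 8 : ℝ)) := by
  have h : Real.exp (-(1 / 8 : ℝ)) = Real.exp (-(1 / 16 : ℝ)) ^ 2 := by
    rw [← Real.exp_nat_mul]; congr 1; norm_num
  rw [h]
  exact pow_lt_pow_left₀ p_bounds.1 (by norm_num) (by norm_num)

/-- Each exponential term `e^{−(1/8)·n}` (`n : ℕ`) dominates `(0.9394²)^n`. [folklore] -/
theorem exp_term_ge (n : ℕ) :
    ((0.9394 : ℝ) ^ 2) ^ n ≤ Real.exp (-((1 / 8 : ℝ) * n)) := by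
  have h : Real.exp (-((1 / 8 : ℝ) * n)) = Real.exp (-(1 / 8 : ℝ)) ^ n := by
    rw [← Real.exp_nat_mul]; congr 1; ring
  rw [h]
  exact pow_le_pow_left₀ (by norm_num) q_lower.le n

/-- Rational lower bound for `S1 (1/8) 24`. [folklore] -/
theorem S1_ge : ∑ k ∈ range 49, ((0.9394 : ℝ) ^ 2) ^ wN 24 k ≤ S1 (1 / 8) 24 := by
  unfold S1
  apply Finset.sum_le_sum
  intro k _
  exact exp_term_ge _

/-- Rational lower bound for `SR (1/8)`. [folklore] -/
theorem SR_ge : ∑ ρ ∈ range 32, ((0.9394 : ℝ) ^ 2) ^ wN 15 ρ ≤ SR (1 / 8) := by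
  unfold SR
  apply Finset.sum_le_sum
  intro ρ _
  exact exp_term_ge _

/-- Rational lower bound for `St (1/8) 24`. [folklore] -/
theorem St_ge : ∑ t ∈ range 24, ((0.9394 : ℝ) ^ 2) ^ (4 + t) ≤ St (1 / 8) 24 := by
  unfold St
  apply Finset.sum_le_sum
  intro t _
  have := exp_term_ge (4 + t)
  push_cast at this
  exact this

/-- Rational lower bound for `Sm (1/8) 24`. [folklore] -/
theorem Sm_ge : ∑ m ∈ range 25, ((0.9394 : ℝ) ^ 2) ^ (1 + m) ≤ Sm (1 / 8) 24 := by
  unfold Sm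
  apply Finset.sum_le_sum
  intro m _
  have := exp_term_ge (1 + m)
  push_cast at this
  exact this

/-- The four rational partial sums, evaluated. [folklore] -/
theorem rational_sums_eval :
    (∑ k ∈ range 49, ((0.9394 : ℝ) ^ 2) ^ wN 24 k) ≥ 15.2 ∧
    (∑ ρ ∈ range 32, ((0.9394 : ℝ) ^ 2) ^ wN 15 ρ) ≥ 13.8 ∧
    (∑ t ∈ range 24, ((0.9394 : ℝ) ^ 2) ^ (4 + t)) ≥ 4.9 ∧
    (∑ m ∈ range 25, ((0.9394 : ℝ) ^ 2) ^ (1 + m)) ≥ 7.1 := by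
  simp only [Finset.sum_range_succ, Finset.sum_range_zero, wN]
  norm_num

/-- **The printed constant is exceeded**: `B6.c1 4 δ₀ α < witnessSum (1/8) 24 24 24` whenever `αδ₀ = 1/8`.
[cite: Balaban1984PropagatorsII, Lemma 2.1 p.234 (c₁(α) = 12c₀^d(½α))] -/
theorem witnessSum_gt_c1 {δ₀ α : ℝ} (h : α * δ₀ = 1 / 8) :
    B6.c1 4 δ₀ α < witnessSum (1 / 8) 24 24 24 := by
  -- upper bound for the printed constant
  have hpos : 0 < α / 2 * δ₀ := by nlinarith
  have hc0 : B6.c0 δ₀ (α / 2) = (1 + Real.exp (-(1 / 16 : ℝ))) / (1 - Real.exp (-(1 / 16 : ℝ))) := by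
    rw [c0_closed hpos]; congr 2 <;> (congr 1; congr 1; linarith)
  obtain ⟨hp1, hp2⟩ := p_bounds
  set p := Real.exp (-(1 / 16 : ℝ)) with hp
  have hc0_le : B6.c0 δ₀ (α / 2) ≤ (1 + 0.9395) / (1 - 0.9395) := by
    rw [hc0, div_le_div_iff₀ (by linarith) (by norm_num)]
    nlinarith
  have hc1_le : B6.c1 4 δ₀ α ≤ 12 * ((1 + 0.9395) / (1 - 0.9395)) ^ 4 := by
    unfold B6.c1
    have h0 : 0 ≤ B6.c0 δ₀ (α / 2) := by
      rw [hc0]; apply div_nonneg <;> linarith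
    have := pow_le_pow_left₀ h0 hc0_le 4
    linarith
  -- lower bound for the witness sum
  obtain ⟨h1, h2, h3', h4⟩ := rational_sums_eval
  have hS1 := S1_ge
  have hSR := SR_ge
  have hSt := St_ge
  have hSm := Sm_ge
  have hS1' : (15.2 : ℝ) ≤ S1 (1 / 8) 24 := le_trans h1 hS1
  have hSR' : (13.8 : ℝ) ≤ SR (1 / 8) := le_trans h2 hSR
  have hSt' : (4.9 : ℝ) ≤ St (1 / 8) 24 := le_trans h3' hSt
  have hSm' : (7.1 : ℝ) ≤ Sm (1 / 8) 24 := le_trans h4 hSm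
  have hprod : (15.2 * 13.8 : ℝ) ≤ S1 (1 / 8) 24 * SR (1 / 8) :=
    mul_le_mul hS1' hSR' (by norm_num) (by linarith)
  have hcube : ((15.2 * 13.8 : ℝ)) ^ 3 ≤ (S1 (1 / 8) 24 * SR (1 / 8)) ^ 3 :=
    pow_le_pow_left₀ (by norm_num) hprod 3
  have hcube1 : (15.2 : ℝ) ^ 3 ≤ S1 (1 / 8) 24 ^ 3 := pow_le_pow_left₀ (by norm_num) hS1' 3
  have hA : (4.9 : ℝ) * (15.2 * 13.8) ^ 3 ≤ St (1 / 8) 24 * (S1 (1 / 8) 24 * SR (1 / 8)) ^ 3 :=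
    mul_le_mul hSt' hcube (by norm_num) (by linarith)
  have hB : (7.1 : ℝ) * 15.2 ^ 3 ≤ Sm (1 / 8) 24 * S1 (1 / 8) 24 ^ 3 :=
    mul_le_mul hSm' hcube1 (by norm_num) (by linarith)
  unfold witnessSum
  have : (12 : ℝ) * ((1 + 0.9395) / (1 - 0.9395)) ^ 4 < 4.9 * (15.2 * 13.8) ^ 3 + 7.1 * 15.2 ^ 3 := by
    norm_num
  linarith

/-- **Assembled refutation of the printed (2.61) in d = 4.** In any finite geometry carrying the witness family
(distinct sites, path bounds as stated), at `αδ₀ = 1/8` the sum `Σ_{y′} e^{−αδ₀ d(y,y′)}` at the witness base point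
exceeds the printed `c₁(α) = 12c₀⁴(½α)`. [cite: Balaban1984PropagatorsII, Lemma 2.1 (2.61) p.234] -/
theorem printed_c1_exceeded {S : Type*} [Fintype S] [DecidableEq S]
    (dist : S → S → ℝ) (y : S) {δ₀ α : ℝ} (h : α * δ₀ = 1 / 8)
    (fine coarse : ℕ → ℤ × ℤ × ℤ → S)
    (hinj : Set.InjOn (siteMap 24 fine coarse) ↑(witnessIdx 24 24 24))
    (hfine : ∀ i ∈ fineIdx 24 24, dist y (siteMap 24 fine coarse (Sum.inl i)) ≤ fineBound 24 i)
    (hcoarse : ∀ i ∈ coarseIdx 24 24, dist y (siteMap 24 fine coarse (Sum.inr i)) ≤ coarseBound 24 i) :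
    B6.c1 4 δ₀ α < ∑ y' : S, Real.exp (-(α * δ₀ * dist y y')) := by
  have hw := witnessSum_le_sum dist y (1 / 8) (by norm_num) 24 24 24 fine coarse hinj hfine hcoarse
  rw [h]
  exact lt_of_lt_of_le (witnessSum_gt_c1 h) hw

end Literature.MathematicalPhysics.QuantumFieldTheory.Balaban1983to89.B6Lemma21Counterexample
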